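import Literature.Geometry.Kaehler.ManifoldFormsPullback
import HarnessLib

/-!
# Pull-back of forms along maps defined on a subset of a vector space (within-set derivative)

Support for the integration proof of **de Rham's theorem**: a smooth singular simplex of a
manifold `M` is a map `Δⁿ → M` that is `C^∞` *within* the closed simplex
(`…SingularSimplex.IsSmooth`, `ContMDiffOn` on `Δⁿ`), and integration of a form over it pulls
the form back along a map `f : E' → M` from a flat parameter space that is only smooth within a
closed set `s` (a cube). The tree's pull-back `MForm.pullback` (`FormsAlgebra`) uses the
unrestricted derivative `mfderiv`, which is junk at boundary points of `s`; here we use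
`mfderivWithin`:

* `MForm.pullbackWithin β f s x = β (f x) ∘ (mfderivWithin 𝓘(ℝ, E') I f s x)^{⊗k}` — a form on the
  flat space `E'`;
* `MForm.pullbackWithin_eq_pullback_of_mem_nhds`: at interior points of `s` it is the tree's
  pull-back;
* `MForm.pullbackWithin_eq_inChart_comp`: **the pull-back in a chart** — for `x ∈ s` with `f x` in
  the source of the chart at `p`, `(f^*_s β)(x) = (β.inChart p (g x)) ∘ (fderivWithin ℝ g s x)`,
  `g = extChartAt I p ∘ f` (the within-set twin of the tree's `MForm.inChart_pullback_eq`,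
  Warner (1983), 2.22);
* `MForm.contDiffWithinAt_pullbackWithin`, `MForm.contDiffOn_pullbackWithin`: if `f` is `C^∞`
  within `s` (`UniqueDiffOn`) and `β` is smooth at the points `f x`, then `f^*_s β` is `C^∞`
  within `s` — in particular continuous up to the boundary of a cube, as Stokes' theorem via the
  divergence theorem requires;
* `MForm.extDeriv_pullbackWithin_of_mem_nhds`: `d(f^*_s β) = f^*_s(dβ)` at interior points of `s`
  (naturality of `d`, Warner (1983), Prop. 2.23, through the tree's `mextDeriv_pullback_apply`).

## References

* F. W. Warner, *Foundations of Differentiable Manifolds and Lie Groups*, GTM 94 (1983), 2.22–2.23,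
  4.17 (integration over smooth singular simplices).
* J. M. Lee, *Introduction to Smooth Manifolds*, 2nd ed. (2013), Lemma 14.16, Prop. 14.26, p. 473.
-/

noncomputable section

open scoped Manifold ContDiff Topology
open Bundle Set Filter

namespace Literature.Geometry.Kaehler

variable {E : Type*} [NormedAddCommGroup E] [NormedSpace ℝ E]
  {H : Type*} [TopologicalSpace H] {I : ModelWithCorners ℝ E H}
  {M : Type*} [TopologicalSpace M] [ChartedSpace H M]
  {E' : Type*} [NormedAddCommGroup E'] [NormedSpace ℝ E']
  {F : Type*} [NormedAddCommGroup F] [NormedSpace ℝ F] {k : ℕ}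

/-- **The pull-back of a form along a map from a flat space, within a set**:
`(f^*_s β)(x)(v₁, …, v_k) = β(f x)(Df_s(x) v₁, …, Df_s(x) v_k)` with
`Df_s(x) = mfderivWithin 𝓘(ℝ, E') I f s x` the derivative of `f : E' → M` within `s` at `x`
(Warner (1983), 2.22 / 4.17: the pull-back along a simplex smooth on a neighbourhood of each of
its points, phrased choice-free with the within-set derivative). A form on the vector space `E'`
(model `𝓘(ℝ, E')`). Dot-notation extension of `MForm`, declared from `Literature/Geometry/Manifold`'s
de Rham series. [cite: WarnerGTM94, 4.17] -/
def MForm.pullbackWithin (β : MForm I M F k) (f : E' → M) (s : Set E') :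
    E' → E' [⋀^Fin k]→L[ℝ] F :=
  fun x ↦ (β (f x)).compContinuousLinearMap (mfderivWithin 𝓘(ℝ, E') I f s x)

/-- Evaluation of the within-set pull-back (definitional). [cite: WarnerGTM94, 2.22] -/
@[simp]
theorem MForm.pullbackWithin_apply (β : MForm I M F k) (f : E' → M) (s : Set E') (x : E')
    (v : Fin k → E') :
    β.pullbackWithin f s x v = β (f x) (fun i ↦ mfderivWithin 𝓘(ℝ, E') I f s x (v i)) :=
  rfl

/-- The within-set pull-back is additive in the form. [folklore] -/
theorem MForm.pullbackWithin_add (β₁ β₂ : MForm I M F k) (f : E' → M) (s : Set E') :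
    (β₁ + β₂).pullbackWithin f s = β₁.pullbackWithin f s + β₂.pullbackWithin f s :=
  rfl

/-- The within-set pull-back is homogeneous in the form. [folklore] -/
theorem MForm.pullbackWithin_smul (c : ℝ) (β : MForm I M F k) (f : E' → M) (s : Set E') :
    (c • β).pullbackWithin f s = c • β.pullbackWithin f s :=
  rfl

/-- The within-set pull-back of the zero form is zero. [folklore] -/
@[simp]
theorem MForm.pullbackWithin_zero (f : E' → M) (s : Set E') :
    (0 : MForm I M F k).pullbackWithin f s = 0 := by
  funext x
  ext v
  simp [MForm.pullbackWithin]

/-- **At interior points of `s` the within-set pull-back is the pull-back** (the derivative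
within a neighbourhood is the derivative). [folklore] -/
theorem MForm.pullbackWithin_eq_pullback_of_mem_nhds (β : MForm I M F k) (f : E' → M) {s : Set E'}
    {x : E'} (hs : s ∈ 𝓝 x) : β.pullbackWithin f s x = β.pullback 𝓘(ℝ, E') f x := by
  ext v
  change (β (f x)) (fun i ↦ mfderivWithin 𝓘(ℝ, E') I f s x (v i)) =
    (β (f x)) (fun i ↦ mfderiv 𝓘(ℝ, E') I f x (v i))
  rw [mfderivWithin_of_mem_nhds hs]

/-- Near an interior point of `s` the within-set pull-back is eventually the pull-back. [folklore] -/
theorem MForm.pullbackWithin_eventuallyEq_pullback (β : MForm I M F k) (f : E' → M) {s : Set E'}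
    {x : E'} (hs : s ∈ 𝓝 x) :
    β.pullbackWithin f s =ᶠ[𝓝 x] (fun y ↦ β.pullback 𝓘(ℝ, E') f y : E' → E' [⋀^Fin k]→L[ℝ] F) := by
  obtain ⟨U, hUs, hU, hxU⟩ := mem_nhds_iff.1 hs
  filter_upwards [hU.mem_nhds hxU] with y hy
  exact β.pullbackWithin_eq_pullback_of_mem_nhds f (mem_of_superset (hU.mem_nhds hy) hUs)

section Chart

variable [IsManifold I ∞ M]

/-- **The within-set pull-back in a chart** (within-set twin of `MForm.inChart_pullback_eq`;
Warner (1983), 2.22). Let `x ∈ s` be a point of unique differentiability of `s` at which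
`f : E' → M` is differentiable within `s`, with `f x` in the source of the chart at `p`, and write
`g = extChartAt I p ∘ f`. Then `(f^*_s β)(x) = (β.inChart p (g x)) ∘ (fderivWithin ℝ g s x)`
(chain rule for `f = (extChartAt I p)⁻¹ ∘ g` near `x` within `s`). [cite: WarnerGTM94, 2.22] -/
theorem MForm.pullbackWithin_eq_inChart_comp (β : MForm I M F k) {f : E' → M} {s : Set E'} {p : M}
    {x : E'} (hU : UniqueDiffWithinAt ℝ s x)
    (hfs : f x ∈ (extChartAt I p).source) (hf : MDifferentiableWithinAt 𝓘(ℝ, E') I f s x) :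
    β.pullbackWithin f s x =
      (β.inChart p (extChartAt I p (f x))).compContinuousLinearMap
        (fderivWithin ℝ (extChartAt I p ∘ f) s x) := by
  set g : E' → E := extChartAt I p ∘ f with hg
  have hU' : UniqueMDiffWithinAt 𝓘(ℝ, E') s x := hU.uniqueMDiffWithinAt
  have hgt : g x ∈ (extChartAt I p).target := (extChartAt I p).map_source hfs
  have hfz : (extChartAt I p).symm (g x) = f x := (extChartAt I p).left_inv hfs
  have hmaps : s ⊆ g ⁻¹' range I := fun w _ ↦ by
    simp only [hg, mem_preimage, Function.comp_apply, extChartAt_coe]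
    exact mem_range_self _
  -- (1) `f = chart⁻¹ ∘ g` near `x` within `s`
  have h2 : f =ᶠ[𝓝[s] x] ((extChartAt I p).symm ∘ g) := by
    have h3 : ∀ᶠ w in 𝓝[s] x, f w ∈ (extChartAt I p).source :=
      hf.continuousWithinAt.preimage_mem_nhdsWithin (extChartAt_source_mem_nhds' hfs)
    filter_upwards [h3] with w hw
    simp only [Function.comp_apply, hg, (extChartAt I p).left_inv hw]
  have h3 : mfderivWithin 𝓘(ℝ, E') I f s x =
      mfderivWithin 𝓘(ℝ, E') I ((extChartAt I p).symm ∘ g) s x :=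
    h2.mfderivWithin_eq (by simp only [Function.comp_apply, hfz])
  -- (2) `D(chart⁻¹ ∘ g)(x) = D(chart⁻¹)(g x) ∘ Dg(x)`
  have hgd : MDifferentiableWithinAt 𝓘(ℝ, E') 𝓘(ℝ, E) g s x :=
    (mdifferentiableAt_extChartAt (by rw [← extChartAt_source I]; exact hfs)).comp_mdifferentiableWithinAt
      x hf
  have h4 : mfderivWithin 𝓘(ℝ, E') I ((extChartAt I p).symm ∘ g) s x =
      (mfderivWithin 𝓘(ℝ, E) I (extChartAt I p).symm (range I) (g x)).comp
        (mfderivWithin 𝓘(ℝ, E') 𝓘(ℝ, E) g s x) :=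
    mfderivWithin_comp x (mdifferentiableWithinAt_extChartAt_symm hgt) hgd hmaps hU'
  have h5 : mfderivWithin 𝓘(ℝ, E') 𝓘(ℝ, E) g s x = fderivWithin ℝ g s x :=
    mfderivWithin_eq_fderivWithin
  have key := h3.trans h4
  rw [h5] at key
  ext v
  simp only [MForm.inChart_apply, MForm.pullbackWithin_apply,
    ContinuousAlternatingMap.compContinuousLinearMap_apply, Function.comp_apply]
  rw [(extChartAt I p).left_inv hfs]
  congr 1
  funext i
  exact ContinuousLinearMap.ext_iff.1 key (v i)

/-- **The within-set pull-back in a chart, eventually**: if `f` is `C¹` within `s`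
(`UniqueDiffOn`) near `x ∈ s`, then near `x` within `s` the within-set pull-back is the chart
expression of `MForm.pullbackWithin_eq_inChart_comp` in the chart at `f x`. [cite: WarnerGTM94, 2.22] -/
theorem MForm.pullbackWithin_eventuallyEq_inChart_comp (β : MForm I M F k) {f : E' → M} {s : Set E'}
    {x : E'} (hxs : x ∈ s) (hs : UniqueDiffOn ℝ s) {n : WithTop ℕ∞} (hn : n ≠ 0)
    (hf : ContMDiffOn 𝓘(ℝ, E') I n f s) :
    β.pullbackWithin f s =ᶠ[𝓝[s] x] fun y ↦
      (β.inChart (f x) (extChartAt I (f x) (f y))).compContinuousLinearMap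
        (fderivWithin ℝ (extChartAt I (f x) ∘ f) s y) := by
  have hsrc : ∀ᶠ y in 𝓝[s] x, f y ∈ (extChartAt I (f x)).source :=
    (hf x hxs).continuousWithinAt.preimage_mem_nhdsWithin (extChartAt_source_mem_nhds (f x))
  filter_upwards [hsrc, self_mem_nhdsWithin] with y hy hys
  exact β.pullbackWithin_eq_inChart_comp (hs y hys) hy ((hf y hys).mdifferentiableWithinAt hn)

omit [IsManifold I ∞ M] in
/-- In the flat source, `C^n` within `s` in the manifold sense reads, in the chart at `f x`, as
`C^n` within `s` of `extChartAt I (f x) ∘ f`. [folklore] -/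
theorem contDiffWithinAt_extChartAt_comp_of_contMDiffWithinAt {f : E' → M} {s : Set E'} {x : E'}
    {n : WithTop ℕ∞} (hf : ContMDiffWithinAt 𝓘(ℝ, E') I n f s x) :
    ContDiffWithinAt ℝ n (extChartAt I (f x) ∘ f) s x := by
  have h := (contMDiffWithinAt_iff.1 hf).2
  simpa only [writtenInExtChartAt, extChartAt_model_space_eq_id, PartialEquiv.refl_coe,
    PartialEquiv.refl_symm, Function.comp_id, id_eq, preimage_id_eq, modelWithCornersSelf_coe,
    range_id, inter_univ] using h

/-- **The within-set pull-back of a smooth form along a map `C^∞` within `s` is `C^∞` within `s`**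
(pointwise; Warner (1983), 2.22, the within-set form of `MForm.SmoothAt.pullback`): in the chart
at `f x` it is a `C^∞` expression in `(β.inChart (f x) ∘ g, Dg_s)`, `g = extChartAt I (f x) ∘ f`.
[cite: WarnerGTM94, 2.22] -/
theorem MForm.contDiffWithinAt_pullbackWithin {β : MForm I M F k} {f : E' → M} {s : Set E'} {x : E'}
    (hxs : x ∈ s) (hs : UniqueDiffOn ℝ s) (hf : ContMDiffOn 𝓘(ℝ, E') I ∞ f s)
    (hβ : β.SmoothAt (f x)) : ContDiffWithinAt ℝ ∞ (β.pullbackWithin f s) s x := by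
  have hg : ContDiffWithinAt ℝ ∞ (extChartAt I (f x) ∘ f) s x :=
    contDiffWithinAt_extChartAt_comp_of_contMDiffWithinAt (hf x hxs)
  have hmaps : MapsTo (extChartAt I (f x) ∘ f) s (range I) := fun w _ ↦ by
    simp only [Function.comp_apply, extChartAt_coe]
    exact mem_range_self _
  have hev := β.pullbackWithin_eventuallyEq_inChart_comp hxs hs (by simp) hf
  have hsm : ContDiffWithinAt ℝ ∞ (fun y ↦
      (β.inChart (f x) (extChartAt I (f x) (f y))).compContinuousLinearMap
        (fderivWithin ℝ (extChartAt I (f x) ∘ f) s y)) s x := by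
    refine
      Literature.NumberTheory.Transcendental.ContDiffWithinAt.continuousAlternatingMapCompContinuousLinearMap
      ?_ ?_
    · have hβ' : ContDiffWithinAt ℝ ∞ (β.inChart (f x)) (range I) ((extChartAt I (f x) ∘ f) x) := hβ
      exact hβ'.comp x hg hmaps
    · exact hg.fderivWithin_right hs (by simp) hxs
  exact hsm.congr_of_eventuallyEq hev (hev.self_of_nhdsWithin hxs)

/-- **The within-set pull-back is `C^∞` within `s`** (all points): for `f` `C^∞` within the
`UniqueDiffOn` set `s` and `β` smooth at every `f x`, `x ∈ s`. [cite: WarnerGTM94, 2.22] -/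
theorem MForm.contDiffOn_pullbackWithin {β : MForm I M F k} {f : E' → M} {s : Set E'}
    (hs : UniqueDiffOn ℝ s) (hf : ContMDiffOn 𝓘(ℝ, E') I ∞ f s) (hβ : ∀ x ∈ s, β.SmoothAt (f x)) :
    ContDiffOn ℝ ∞ (β.pullbackWithin f s) s := fun x hx ↦
  MForm.contDiffWithinAt_pullbackWithin hx hs hf (hβ x hx)

/-- The within-set pull-back is continuous on `s` under the same hypotheses. [cite: WarnerGTM94, 2.22] -/
theorem MForm.continuousOn_pullbackWithin {β : MForm I M F k} {f : E' → M} {s : Set E'}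
    (hs : UniqueDiffOn ℝ s) (hf : ContMDiffOn 𝓘(ℝ, E') I ∞ f s) (hβ : ∀ x ∈ s, β.SmoothAt (f x)) :
    ContinuousOn (β.pullbackWithin f s) s :=
  (MForm.contDiffOn_pullbackWithin hs hf hβ).continuousOn

/-- **Naturality of `d` for the within-set pull-back, at interior points**: if `s` is a
neighbourhood of `x`, `f` is `C^∞` within `s` and `β` is smooth at `f x`, then
`d(f^*_s β)(x) = (f^*_s dβ)(x)`, where `d` on the flat space is Mathlib's `extDeriv`
(Warner (1983), Prop. 2.23, via the tree's pointwise `mextDeriv_pullback_apply`). [cite: WarnerGTM94, Prop. 2.23] -/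
theorem MForm.extDeriv_pullbackWithin_of_mem_nhds {β : MForm I M F k} {f : E' → M} {s : Set E'}
    {x : E'} (hs : s ∈ 𝓝 x) (hf : ContMDiffOn 𝓘(ℝ, E') I ∞ f s) (hβ : β.SmoothAt (f x)) :
    extDeriv (β.pullbackWithin f s) x = (mextDeriv β).pullbackWithin f s x := by
  have hfev : ∀ᶠ z in 𝓝 x, ContMDiffAt 𝓘(ℝ, E') I ∞ f z := by
    obtain ⟨U, hUs, hU, hxU⟩ := mem_nhds_iff.1 hs
    filter_upwards [hU.mem_nhds hxU] with z hz
    exact (hf z (hUs hz)).contMDiffAt (mem_of_superset (hU.mem_nhds hz) hUs)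
  have h1 : extDeriv (fun y ↦ β.pullback 𝓘(ℝ, E') f y : E' → E' [⋀^Fin k]→L[ℝ] F) x =
      mextDeriv (β.pullback 𝓘(ℝ, E') f) x :=
    (mextDeriv_eq_extDeriv (β.pullback 𝓘(ℝ, E') f) x).symm
  rw [(β.pullbackWithin_eventuallyEq_pullback f hs).extDeriv_eq, h1, mextDeriv_pullback_apply hfev hβ,
    (mextDeriv β).pullbackWithin_eq_pullback_of_mem_nhds f hs]

/-- The same with `extDerivWithin` on the left (at interior points `extDerivWithin = extDeriv`). [cite: WarnerGTM94, Prop. 2.23] -/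
theorem MForm.extDerivWithin_pullbackWithin_of_mem_nhds {β : MForm I M F k} {f : E' → M} {s : Set E'}
    {x : E'} (hs : s ∈ 𝓝 x) (hf : ContMDiffOn 𝓘(ℝ, E') I ∞ f s) (hβ : β.SmoothAt (f x)) :
    extDerivWithin (β.pullbackWithin f s) s x = (mextDeriv β).pullbackWithin f s x := by
  rw [← MForm.extDeriv_pullbackWithin_of_mem_nhds hs hf hβ, extDerivWithin, extDeriv,
    fderivWithin_of_mem_nhds hs]

end Chart

end Literature.Geometry.Kaehler
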